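import Summits.ValiantsHypothesis.ValiantsHypothesis.Theorems.LacunarySymmetroidMatrixDescartesCensusTwoRowBoxLeaf

/-!
# `MatrixDescartes` census — W4 boundary layer, kernel kit: TWO-ROW-BOX LEAF, part 3 — the wrapper to a hull-edge form

HONEST FRAMING — as in `…CensusTwoRowBoxLeaf` (library file, engine-1 g25, O4 / R1945 / R1950 interface of record; item
`DoorA26 = PosRootLawAt 2 6 19`, stmt-ValiantsHypothesis-19979, OPEN, typed, never asserted).  For a fewnomial `F = Σ_{t<n} c_t X^{e_t}`
(the edge form of a generated kill file, tables `c`, `e`), KEPT indices `r_1..r_m` (row `i₁`, exponents `a + d_j`) and `s_1..s_m` (row `i₂`,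
exponents `b + d_j`), pairwise distinct and `< n`, and the SIGNED twist products `P_t = ∏_{v ∉ kept} (e_t − e_v)` given as closed-numeral
hypotheses (discharged by `norm_num` in the emitter's Rows files, exactly as for the circuit rows): killing the other `n − 2m` exponents
(`countP_posRoots_le_countP_twists`) leaves the explicit two-row residual, so `roots⁺(F) ≤ (n − 2m) + R` for ANY bound `R` on the residual's
positive roots — `R = 1` from `countP_posRoots_twoRow_m_le_one` (+ a certificate such as `twoRow_m_form_neg_of_sdd`), `R = V + 1` from
`countP_posRoots_twoRow_m_le_signChanges_add_one`.  Two orientations: `…_pos` (row `i₁` carries the positive twisted coefficients: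
`A_j = c_{r_j} P_{r_j}`, `B_j = −c_{s_j} P_{s_j}`) and `…_neg` (`A_j = −c_{r_j} P_{r_j}`, `B_j = c_{s_j} P_{s_j}`).  NO sign hypothesis is needed
here — signs enter only where the emitter proves `B₁ > 0`, `B_j ≥ 0` and the certificate.  Nothing here bounds `ζ_sym(2,6)`, decides `DoorA26`,
or bears on `MatrixDescartes` (stmt-ValiantsHypothesis-18050) / `VP ≠ VNP`.

[folklore] Euler twists (iterated Rolle with multiplicity) + bookkeeping of a finite sum; no single source.
-/

set_option linter.dupNamespace false

namespace Summit.ValiantsHypothesis.ValiantsHypothesis.Theorems.LacunarySymmetroidMatrixDescartes.Census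

open Polynomial Finset
open scoped BigOperators Polynomial

/-- **Wrapper, `m = 2`, orientation `pos`.**  Killing every exponent of `F = Σ_{t<n} c_t X^{e_t}` except the kept
`r_j` (`e = a + d_j`) and `s_j` (`e = b + d_j`) leaves the two-row residual with `A_j = c_{r_j}P_{r_j}`,
`B_j = −c_{s_j}P_{s_j}`; hence `roots⁺(F) ≤ (n − 4) + R` for any bound `R` on its positive roots. [folklore] -/
theorem countP_posRoots_rsum_le_of_twoRow₂_pos {n : ℕ} (e : ℕ → ℕ) (c : ℕ → ℝ)
    (r₁ r₂ s₁ s₂ : ℕ) (hr₁n : r₁ < n) (hr₂n : r₂ < n) (hs₁n : s₁ < n) (hs₂n : s₂ < n)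
    (hnodup : List.Nodup [r₁, r₂, s₁, s₂])
    (a b d₁ d₂ : ℕ) (her₁ : e r₁ = a + d₁) (her₂ : e r₂ = a + d₂) (hes₁ : e s₁ = b + d₁) (hes₂ : e s₂ = b + d₂)
    (Pr₁ Pr₂ Ps₁ Ps₂ : ℝ)
    (hPr₁ : ∏ v ∈ ((range n).filter (fun v => ¬(v = r₁ ∨ v = r₂ ∨ v = s₁ ∨ v = s₂))), ((e r₁ : ℝ) - e v) = Pr₁)
    (hPr₂ : ∏ v ∈ ((range n).filter (fun v => ¬(v = r₁ ∨ v = r₂ ∨ v = s₁ ∨ v = s₂))), ((e r₂ : ℝ) - e v) = Pr₂)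
    (hPs₁ : ∏ v ∈ ((range n).filter (fun v => ¬(v = r₁ ∨ v = r₂ ∨ v = s₁ ∨ v = s₂))), ((e s₁ : ℝ) - e v) = Ps₁)
    (hPs₂ : ∏ v ∈ ((range n).filter (fun v => ¬(v = r₁ ∨ v = r₂ ∨ v = s₁ ∨ v = s₂))), ((e s₂ : ℝ) - e v) = Ps₂)
    (R : ℕ) (hres : (C (c r₁ * Pr₁) * X ^ (a + d₁) + C (c r₂ * Pr₂) * X ^ (a + d₂) - (C (-(c s₁ * Ps₁)) * X ^ (b + d₁) + C (-(c s₂ * Ps₂)) * X ^ (b + d₂)) : ℝ[X]).roots.countP (fun x => 0 < x) ≤ R) :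
    (∑ t ∈ range n, C (c t) * X ^ (e t) : ℝ[X]).roots.countP (fun x => 0 < x) ≤ (n - 4) + R := by
  classical
  set U : Finset ℕ := ((range n).filter (fun v => ¬(v = r₁ ∨ v = r₂ ∨ v = s₁ ∨ v = s₂))) with hU_def
  have hK : (range n).filter (fun v => v = r₁ ∨ v = r₂ ∨ v = s₁ ∨ v = s₂) = insert r₁ (insert r₂ (insert s₁ {s₂})) := by
    ext v
    simp only [mem_filter, mem_range, mem_insert, mem_singleton]
    constructor
    · rintro ⟨-, h⟩; exact h
    · intro h; refine ⟨?_, h⟩; rcases h with rfl | rfl | rfl | rfl <;> assumption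
  simp only [List.nodup_cons, List.mem_cons, List.not_mem_nil, List.nodup_nil, not_or, or_false, and_true] at hnodup
  have hn1 : r₁ ∉ (insert r₂ (insert s₁ {s₂}) : Finset ℕ) := by simp only [mem_insert, mem_singleton, not_or]; exact hnodup.1
  have hn2 : r₂ ∉ (insert s₁ {s₂} : Finset ℕ) := by simp only [mem_insert, mem_singleton, not_or]; exact hnodup.2.1
  have hn3 : s₁ ∉ ({s₂} : Finset ℕ) := by simp only [mem_singleton]; exact hnodup.2.2.1
  have hKcard : (insert r₁ (insert r₂ (insert s₁ {s₂})) : Finset ℕ).card = 4 := by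
    rw [card_insert_of_notMem hn1, card_insert_of_notMem hn2, card_insert_of_notMem hn3, card_singleton]
  have hUcard : U.card = n - 4 := by
    have h := Finset.card_filter_add_card_filter_not (s := range n) (fun v => v = r₁ ∨ v = r₂ ∨ v = s₁ ∨ v = s₂)
    rw [hK, hKcard, card_range] at h
    rw [hU_def]; omega
  -- capacity
  have step := countP_posRoots_le_countP_twists n e c U
  -- the residual
  have hres_eq : (∑ t ∈ range n, C (c t * ∏ u ∈ U, ((e t : ℝ) - e u)) * X ^ (e t) : ℝ[X]) = (C (c r₁ * Pr₁) * X ^ (a + d₁) + C (c r₂ * Pr₂) * X ^ (a + d₂) - (C (-(c s₁ * Ps₁)) * X ^ (b + d₁) + C (-(c s₂ * Ps₂)) * X ^ (b + d₂)) : ℝ[X]) := by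
    rw [← Finset.sum_filter_add_sum_filter_not (range n) (fun v => v = r₁ ∨ v = r₂ ∨ v = s₁ ∨ v = s₂), hK]
    have hzero : ∑ t ∈ (range n).filter (fun v => ¬(v = r₁ ∨ v = r₂ ∨ v = s₁ ∨ v = s₂)), (C (c t * ∏ u ∈ U, ((e t : ℝ) - e u)) * X ^ (e t) : ℝ[X]) = 0 := by
      refine Finset.sum_eq_zero fun t ht => ?_
      have htU : t ∈ U := by rw [hU_def]; exact ht
      rw [Finset.prod_eq_zero htU (sub_self _), mul_zero, map_zero, zero_mul]
    rw [hzero, add_zero]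
    rw [Finset.sum_insert hn1, Finset.sum_insert hn2, Finset.sum_insert hn3, Finset.sum_singleton]
    rw [hPr₁, hPr₂, hPs₁, hPs₂, her₁, her₂, hes₁, hes₂]
    simp only [map_neg, map_mul]
    ring
  rw [hres_eq, hUcard] at step
  omega

/-- **Wrapper, `m = 2`, orientation `neg`.**  Killing every exponent of `F = Σ_{t<n} c_t X^{e_t}` except the kept
`r_j` (`e = a + d_j`) and `s_j` (`e = b + d_j`) leaves the two-row residual with `A_j = −c_{r_j}P_{r_j}`,
`B_j = c_{s_j}P_{s_j}`; hence `roots⁺(F) ≤ (n − 4) + R` for any bound `R` on its positive roots. [folklore] -/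
theorem countP_posRoots_rsum_le_of_twoRow₂_neg {n : ℕ} (e : ℕ → ℕ) (c : ℕ → ℝ)
    (r₁ r₂ s₁ s₂ : ℕ) (hr₁n : r₁ < n) (hr₂n : r₂ < n) (hs₁n : s₁ < n) (hs₂n : s₂ < n)
    (hnodup : List.Nodup [r₁, r₂, s₁, s₂])
    (a b d₁ d₂ : ℕ) (her₁ : e r₁ = a + d₁) (her₂ : e r₂ = a + d₂) (hes₁ : e s₁ = b + d₁) (hes₂ : e s₂ = b + d₂)
    (Pr₁ Pr₂ Ps₁ Ps₂ : ℝ)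
    (hPr₁ : ∏ v ∈ ((range n).filter (fun v => ¬(v = r₁ ∨ v = r₂ ∨ v = s₁ ∨ v = s₂))), ((e r₁ : ℝ) - e v) = Pr₁)
    (hPr₂ : ∏ v ∈ ((range n).filter (fun v => ¬(v = r₁ ∨ v = r₂ ∨ v = s₁ ∨ v = s₂))), ((e r₂ : ℝ) - e v) = Pr₂)
    (hPs₁ : ∏ v ∈ ((range n).filter (fun v => ¬(v = r₁ ∨ v = r₂ ∨ v = s₁ ∨ v = s₂))), ((e s₁ : ℝ) - e v) = Ps₁)
    (hPs₂ : ∏ v ∈ ((range n).filter (fun v => ¬(v = r₁ ∨ v = r₂ ∨ v = s₁ ∨ v = s₂))), ((e s₂ : ℝ) - e v) = Ps₂)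
    (R : ℕ) (hres : (C (-(c r₁ * Pr₁)) * X ^ (a + d₁) + C (-(c r₂ * Pr₂)) * X ^ (a + d₂) - (C (c s₁ * Ps₁) * X ^ (b + d₁) + C (c s₂ * Ps₂) * X ^ (b + d₂)) : ℝ[X]).roots.countP (fun x => 0 < x) ≤ R) :
    (∑ t ∈ range n, C (c t) * X ^ (e t) : ℝ[X]).roots.countP (fun x => 0 < x) ≤ (n - 4) + R := by
  classical
  set U : Finset ℕ := ((range n).filter (fun v => ¬(v = r₁ ∨ v = r₂ ∨ v = s₁ ∨ v = s₂))) with hU_def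
  have hK : (range n).filter (fun v => v = r₁ ∨ v = r₂ ∨ v = s₁ ∨ v = s₂) = insert r₁ (insert r₂ (insert s₁ {s₂})) := by
    ext v
    simp only [mem_filter, mem_range, mem_insert, mem_singleton]
    constructor
    · rintro ⟨-, h⟩; exact h
    · intro h; refine ⟨?_, h⟩; rcases h with rfl | rfl | rfl | rfl <;> assumption
  simp only [List.nodup_cons, List.mem_cons, List.not_mem_nil, List.nodup_nil, not_or, or_false, and_true] at hnodup
  have hn1 : r₁ ∉ (insert r₂ (insert s₁ {s₂}) : Finset ℕ) := by simp only [mem_insert, mem_singleton, not_or]; exact hnodup.1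
  have hn2 : r₂ ∉ (insert s₁ {s₂} : Finset ℕ) := by simp only [mem_insert, mem_singleton, not_or]; exact hnodup.2.1
  have hn3 : s₁ ∉ ({s₂} : Finset ℕ) := by simp only [mem_singleton]; exact hnodup.2.2.1
  have hKcard : (insert r₁ (insert r₂ (insert s₁ {s₂})) : Finset ℕ).card = 4 := by
    rw [card_insert_of_notMem hn1, card_insert_of_notMem hn2, card_insert_of_notMem hn3, card_singleton]
  have hUcard : U.card = n - 4 := by
    have h := Finset.card_filter_add_card_filter_not (s := range n) (fun v => v = r₁ ∨ v = r₂ ∨ v = s₁ ∨ v = s₂)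
    rw [hK, hKcard, card_range] at h
    rw [hU_def]; omega
  -- capacity
  have step := countP_posRoots_le_countP_twists n e c U
  -- the residual
  have hres_eq : (∑ t ∈ range n, C (c t * ∏ u ∈ U, ((e t : ℝ) - e u)) * X ^ (e t) : ℝ[X]) = -(C (-(c r₁ * Pr₁)) * X ^ (a + d₁) + C (-(c r₂ * Pr₂)) * X ^ (a + d₂) - (C (c s₁ * Ps₁) * X ^ (b + d₁) + C (c s₂ * Ps₂) * X ^ (b + d₂)) : ℝ[X]) := by
    rw [← Finset.sum_filter_add_sum_filter_not (range n) (fun v => v = r₁ ∨ v = r₂ ∨ v = s₁ ∨ v = s₂), hK]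
    have hzero : ∑ t ∈ (range n).filter (fun v => ¬(v = r₁ ∨ v = r₂ ∨ v = s₁ ∨ v = s₂)), (C (c t * ∏ u ∈ U, ((e t : ℝ) - e u)) * X ^ (e t) : ℝ[X]) = 0 := by
      refine Finset.sum_eq_zero fun t ht => ?_
      have htU : t ∈ U := by rw [hU_def]; exact ht
      rw [Finset.prod_eq_zero htU (sub_self _), mul_zero, map_zero, zero_mul]
    rw [hzero, add_zero]
    rw [Finset.sum_insert hn1, Finset.sum_insert hn2, Finset.sum_insert hn3, Finset.sum_singleton]
    rw [hPr₁, hPr₂, hPs₁, hPs₂, her₁, her₂, hes₁, hes₂]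
    simp only [map_neg, map_mul]
    ring
  rw [hres_eq, roots_neg, hUcard] at step
  omega

/-- **Wrapper, `m = 3`, orientation `pos`.**  Killing every exponent of `F = Σ_{t<n} c_t X^{e_t}` except the kept
`r_j` (`e = a + d_j`) and `s_j` (`e = b + d_j`) leaves the two-row residual with `A_j = c_{r_j}P_{r_j}`,
`B_j = −c_{s_j}P_{s_j}`; hence `roots⁺(F) ≤ (n − 6) + R` for any bound `R` on its positive roots. [folklore] -/
theorem countP_posRoots_rsum_le_of_twoRow₃_pos {n : ℕ} (e : ℕ → ℕ) (c : ℕ → ℝ)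
    (r₁ r₂ r₃ s₁ s₂ s₃ : ℕ) (hr₁n : r₁ < n) (hr₂n : r₂ < n) (hr₃n : r₃ < n) (hs₁n : s₁ < n) (hs₂n : s₂ < n) (hs₃n : s₃ < n)
    (hnodup : List.Nodup [r₁, r₂, r₃, s₁, s₂, s₃])
    (a b d₁ d₂ d₃ : ℕ) (her₁ : e r₁ = a + d₁) (her₂ : e r₂ = a + d₂) (her₃ : e r₃ = a + d₃) (hes₁ : e s₁ = b + d₁) (hes₂ : e s₂ = b + d₂) (hes₃ : e s₃ = b + d₃)
    (Pr₁ Pr₂ Pr₃ Ps₁ Ps₂ Ps₃ : ℝ)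
    (hPr₁ : ∏ v ∈ ((range n).filter (fun v => ¬(v = r₁ ∨ v = r₂ ∨ v = r₃ ∨ v = s₁ ∨ v = s₂ ∨ v = s₃))), ((e r₁ : ℝ) - e v) = Pr₁)
    (hPr₂ : ∏ v ∈ ((range n).filter (fun v => ¬(v = r₁ ∨ v = r₂ ∨ v = r₃ ∨ v = s₁ ∨ v = s₂ ∨ v = s₃))), ((e r₂ : ℝ) - e v) = Pr₂)
    (hPr₃ : ∏ v ∈ ((range n).filter (fun v => ¬(v = r₁ ∨ v = r₂ ∨ v = r₃ ∨ v = s₁ ∨ v = s₂ ∨ v = s₃))), ((e r₃ : ℝ) - e v) = Pr₃)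
    (hPs₁ : ∏ v ∈ ((range n).filter (fun v => ¬(v = r₁ ∨ v = r₂ ∨ v = r₃ ∨ v = s₁ ∨ v = s₂ ∨ v = s₃))), ((e s₁ : ℝ) - e v) = Ps₁)
    (hPs₂ : ∏ v ∈ ((range n).filter (fun v => ¬(v = r₁ ∨ v = r₂ ∨ v = r₃ ∨ v = s₁ ∨ v = s₂ ∨ v = s₃))), ((e s₂ : ℝ) - e v) = Ps₂)
    (hPs₃ : ∏ v ∈ ((range n).filter (fun v => ¬(v = r₁ ∨ v = r₂ ∨ v = r₃ ∨ v = s₁ ∨ v = s₂ ∨ v = s₃))), ((e s₃ : ℝ) - e v) = Ps₃)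
    (R : ℕ) (hres : (C (c r₁ * Pr₁) * X ^ (a + d₁) + C (c r₂ * Pr₂) * X ^ (a + d₂) + C (c r₃ * Pr₃) * X ^ (a + d₃) - (C (-(c s₁ * Ps₁)) * X ^ (b + d₁) + C (-(c s₂ * Ps₂)) * X ^ (b + d₂) + C (-(c s₃ * Ps₃)) * X ^ (b + d₃)) : ℝ[X]).roots.countP (fun x => 0 < x) ≤ R) :
    (∑ t ∈ range n, C (c t) * X ^ (e t) : ℝ[X]).roots.countP (fun x => 0 < x) ≤ (n - 6) + R := by
  classical
  set U : Finset ℕ := ((range n).filter (fun v => ¬(v = r₁ ∨ v = r₂ ∨ v = r₃ ∨ v = s₁ ∨ v = s₂ ∨ v = s₃))) with hU_def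
  have hK : (range n).filter (fun v => v = r₁ ∨ v = r₂ ∨ v = r₃ ∨ v = s₁ ∨ v = s₂ ∨ v = s₃) = insert r₁ (insert r₂ (insert r₃ (insert s₁ (insert s₂ {s₃})))) := by
    ext v
    simp only [mem_filter, mem_range, mem_insert, mem_singleton]
    constructor
    · rintro ⟨-, h⟩; exact h
    · intro h; refine ⟨?_, h⟩; rcases h with rfl | rfl | rfl | rfl | rfl | rfl <;> assumption
  simp only [List.nodup_cons, List.mem_cons, List.not_mem_nil, List.nodup_nil, not_or, or_false, and_true] at hnodup
  have hn1 : r₁ ∉ (insert r₂ (insert r₃ (insert s₁ (insert s₂ {s₃}))) : Finset ℕ) := by simp only [mem_insert, mem_singleton, not_or]; exact hnodup.1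
  have hn2 : r₂ ∉ (insert r₃ (insert s₁ (insert s₂ {s₃})) : Finset ℕ) := by simp only [mem_insert, mem_singleton, not_or]; exact hnodup.2.1
  have hn3 : r₃ ∉ (insert s₁ (insert s₂ {s₃}) : Finset ℕ) := by simp only [mem_insert, mem_singleton, not_or]; exact hnodup.2.2.1
  have hn4 : s₁ ∉ (insert s₂ {s₃} : Finset ℕ) := by simp only [mem_insert, mem_singleton, not_or]; exact hnodup.2.2.2.1
  have hn5 : s₂ ∉ ({s₃} : Finset ℕ) := by simp only [mem_singleton]; exact hnodup.2.2.2.2.1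
  have hKcard : (insert r₁ (insert r₂ (insert r₃ (insert s₁ (insert s₂ {s₃})))) : Finset ℕ).card = 6 := by
    rw [card_insert_of_notMem hn1, card_insert_of_notMem hn2, card_insert_of_notMem hn3, card_insert_of_notMem hn4, card_insert_of_notMem hn5, card_singleton]
  have hUcard : U.card = n - 6 := by
    have h := Finset.card_filter_add_card_filter_not (s := range n) (fun v => v = r₁ ∨ v = r₂ ∨ v = r₃ ∨ v = s₁ ∨ v = s₂ ∨ v = s₃)
    rw [hK, hKcard, card_range] at h
    rw [hU_def]; omega
  -- capacity
  have step := countP_posRoots_le_countP_twists n e c U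
  -- the residual
  have hres_eq : (∑ t ∈ range n, C (c t * ∏ u ∈ U, ((e t : ℝ) - e u)) * X ^ (e t) : ℝ[X]) = (C (c r₁ * Pr₁) * X ^ (a + d₁) + C (c r₂ * Pr₂) * X ^ (a + d₂) + C (c r₃ * Pr₃) * X ^ (a + d₃) - (C (-(c s₁ * Ps₁)) * X ^ (b + d₁) + C (-(c s₂ * Ps₂)) * X ^ (b + d₂) + C (-(c s₃ * Ps₃)) * X ^ (b + d₃)) : ℝ[X]) := by
    rw [← Finset.sum_filter_add_sum_filter_not (range n) (fun v => v = r₁ ∨ v = r₂ ∨ v = r₃ ∨ v = s₁ ∨ v = s₂ ∨ v = s₃), hK]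
    have hzero : ∑ t ∈ (range n).filter (fun v => ¬(v = r₁ ∨ v = r₂ ∨ v = r₃ ∨ v = s₁ ∨ v = s₂ ∨ v = s₃)), (C (c t * ∏ u ∈ U, ((e t : ℝ) - e u)) * X ^ (e t) : ℝ[X]) = 0 := by
      refine Finset.sum_eq_zero fun t ht => ?_
      have htU : t ∈ U := by rw [hU_def]; exact ht
      rw [Finset.prod_eq_zero htU (sub_self _), mul_zero, map_zero, zero_mul]
    rw [hzero, add_zero]
    rw [Finset.sum_insert hn1, Finset.sum_insert hn2, Finset.sum_insert hn3, Finset.sum_insert hn4, Finset.sum_insert hn5, Finset.sum_singleton]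
    rw [hPr₁, hPr₂, hPr₃, hPs₁, hPs₂, hPs₃, her₁, her₂, her₃, hes₁, hes₂, hes₃]
    simp only [map_neg, map_mul]
    ring
  rw [hres_eq, hUcard] at step
  omega

/-- **Wrapper, `m = 3`, orientation `neg`.**  Killing every exponent of `F = Σ_{t<n} c_t X^{e_t}` except the kept
`r_j` (`e = a + d_j`) and `s_j` (`e = b + d_j`) leaves the two-row residual with `A_j = −c_{r_j}P_{r_j}`,
`B_j = c_{s_j}P_{s_j}`; hence `roots⁺(F) ≤ (n − 6) + R` for any bound `R` on its positive roots. [folklore] -/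
theorem countP_posRoots_rsum_le_of_twoRow₃_neg {n : ℕ} (e : ℕ → ℕ) (c : ℕ → ℝ)
    (r₁ r₂ r₃ s₁ s₂ s₃ : ℕ) (hr₁n : r₁ < n) (hr₂n : r₂ < n) (hr₃n : r₃ < n) (hs₁n : s₁ < n) (hs₂n : s₂ < n) (hs₃n : s₃ < n)
    (hnodup : List.Nodup [r₁, r₂, r₃, s₁, s₂, s₃])
    (a b d₁ d₂ d₃ : ℕ) (her₁ : e r₁ = a + d₁) (her₂ : e r₂ = a + d₂) (her₃ : e r₃ = a + d₃) (hes₁ : e s₁ = b + d₁) (hes₂ : e s₂ = b + d₂) (hes₃ : e s₃ = b + d₃)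
    (Pr₁ Pr₂ Pr₃ Ps₁ Ps₂ Ps₃ : ℝ)
    (hPr₁ : ∏ v ∈ ((range n).filter (fun v => ¬(v = r₁ ∨ v = r₂ ∨ v = r₃ ∨ v = s₁ ∨ v = s₂ ∨ v = s₃))), ((e r₁ : ℝ) - e v) = Pr₁)
    (hPr₂ : ∏ v ∈ ((range n).filter (fun v => ¬(v = r₁ ∨ v = r₂ ∨ v = r₃ ∨ v = s₁ ∨ v = s₂ ∨ v = s₃))), ((e r₂ : ℝ) - e v) = Pr₂)
    (hPr₃ : ∏ v ∈ ((range n).filter (fun v => ¬(v = r₁ ∨ v = r₂ ∨ v = r₃ ∨ v = s₁ ∨ v = s₂ ∨ v = s₃))), ((e r₃ : ℝ) - e v) = Pr₃)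
    (hPs₁ : ∏ v ∈ ((range n).filter (fun v => ¬(v = r₁ ∨ v = r₂ ∨ v = r₃ ∨ v = s₁ ∨ v = s₂ ∨ v = s₃))), ((e s₁ : ℝ) - e v) = Ps₁)
    (hPs₂ : ∏ v ∈ ((range n).filter (fun v => ¬(v = r₁ ∨ v = r₂ ∨ v = r₃ ∨ v = s₁ ∨ v = s₂ ∨ v = s₃))), ((e s₂ : ℝ) - e v) = Ps₂)
    (hPs₃ : ∏ v ∈ ((range n).filter (fun v => ¬(v = r₁ ∨ v = r₂ ∨ v = r₃ ∨ v = s₁ ∨ v = s₂ ∨ v = s₃))), ((e s₃ : ℝ) - e v) = Ps₃)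
    (R : ℕ) (hres : (C (-(c r₁ * Pr₁)) * X ^ (a + d₁) + C (-(c r₂ * Pr₂)) * X ^ (a + d₂) + C (-(c r₃ * Pr₃)) * X ^ (a + d₃) - (C (c s₁ * Ps₁) * X ^ (b + d₁) + C (c s₂ * Ps₂) * X ^ (b + d₂) + C (c s₃ * Ps₃) * X ^ (b + d₃)) : ℝ[X]).roots.countP (fun x => 0 < x) ≤ R) :
    (∑ t ∈ range n, C (c t) * X ^ (e t) : ℝ[X]).roots.countP (fun x => 0 < x) ≤ (n - 6) + R := by
  classical
  set U : Finset ℕ := ((range n).filter (fun v => ¬(v = r₁ ∨ v = r₂ ∨ v = r₃ ∨ v = s₁ ∨ v = s₂ ∨ v = s₃))) with hU_def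
  have hK : (range n).filter (fun v => v = r₁ ∨ v = r₂ ∨ v = r₃ ∨ v = s₁ ∨ v = s₂ ∨ v = s₃) = insert r₁ (insert r₂ (insert r₃ (insert s₁ (insert s₂ {s₃})))) := by
    ext v
    simp only [mem_filter, mem_range, mem_insert, mem_singleton]
    constructor
    · rintro ⟨-, h⟩; exact h
    · intro h; refine ⟨?_, h⟩; rcases h with rfl | rfl | rfl | rfl | rfl | rfl <;> assumption
  simp only [List.nodup_cons, List.mem_cons, List.not_mem_nil, List.nodup_nil, not_or, or_false, and_true] at hnodup
  have hn1 : r₁ ∉ (insert r₂ (insert r₃ (insert s₁ (insert s₂ {s₃}))) : Finset ℕ) := by simp only [mem_insert, mem_singleton, not_or]; exact hnodup.1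
  have hn2 : r₂ ∉ (insert r₃ (insert s₁ (insert s₂ {s₃})) : Finset ℕ) := by simp only [mem_insert, mem_singleton, not_or]; exact hnodup.2.1
  have hn3 : r₃ ∉ (insert s₁ (insert s₂ {s₃}) : Finset ℕ) := by simp only [mem_insert, mem_singleton, not_or]; exact hnodup.2.2.1
  have hn4 : s₁ ∉ (insert s₂ {s₃} : Finset ℕ) := by simp only [mem_insert, mem_singleton, not_or]; exact hnodup.2.2.2.1
  have hn5 : s₂ ∉ ({s₃} : Finset ℕ) := by simp only [mem_singleton]; exact hnodup.2.2.2.2.1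
  have hKcard : (insert r₁ (insert r₂ (insert r₃ (insert s₁ (insert s₂ {s₃})))) : Finset ℕ).card = 6 := by
    rw [card_insert_of_notMem hn1, card_insert_of_notMem hn2, card_insert_of_notMem hn3, card_insert_of_notMem hn4, card_insert_of_notMem hn5, card_singleton]
  have hUcard : U.card = n - 6 := by
    have h := Finset.card_filter_add_card_filter_not (s := range n) (fun v => v = r₁ ∨ v = r₂ ∨ v = r₃ ∨ v = s₁ ∨ v = s₂ ∨ v = s₃)
    rw [hK, hKcard, card_range] at h
    rw [hU_def]; omega
  -- capacity
  have step := countP_posRoots_le_countP_twists n e c U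
  -- the residual
  have hres_eq : (∑ t ∈ range n, C (c t * ∏ u ∈ U, ((e t : ℝ) - e u)) * X ^ (e t) : ℝ[X]) = -(C (-(c r₁ * Pr₁)) * X ^ (a + d₁) + C (-(c r₂ * Pr₂)) * X ^ (a + d₂) + C (-(c r₃ * Pr₃)) * X ^ (a + d₃) - (C (c s₁ * Ps₁) * X ^ (b + d₁) + C (c s₂ * Ps₂) * X ^ (b + d₂) + C (c s₃ * Ps₃) * X ^ (b + d₃)) : ℝ[X]) := by
    rw [← Finset.sum_filter_add_sum_filter_not (range n) (fun v => v = r₁ ∨ v = r₂ ∨ v = r₃ ∨ v = s₁ ∨ v = s₂ ∨ v = s₃), hK]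
    have hzero : ∑ t ∈ (range n).filter (fun v => ¬(v = r₁ ∨ v = r₂ ∨ v = r₃ ∨ v = s₁ ∨ v = s₂ ∨ v = s₃)), (C (c t * ∏ u ∈ U, ((e t : ℝ) - e u)) * X ^ (e t) : ℝ[X]) = 0 := by
      refine Finset.sum_eq_zero fun t ht => ?_
      have htU : t ∈ U := by rw [hU_def]; exact ht
      rw [Finset.prod_eq_zero htU (sub_self _), mul_zero, map_zero, zero_mul]
    rw [hzero, add_zero]
    rw [Finset.sum_insert hn1, Finset.sum_insert hn2, Finset.sum_insert hn3, Finset.sum_insert hn4, Finset.sum_insert hn5, Finset.sum_singleton]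
    rw [hPr₁, hPr₂, hPr₃, hPs₁, hPs₂, hPs₃, her₁, her₂, her₃, hes₁, hes₂, hes₃]
    simp only [map_neg, map_mul]
    ring
  rw [hres_eq, roots_neg, hUcard] at step
  omega

/-- **Wrapper, `m = 4`, orientation `pos`.**  Killing every exponent of `F = Σ_{t<n} c_t X^{e_t}` except the kept
`r_j` (`e = a + d_j`) and `s_j` (`e = b + d_j`) leaves the two-row residual with `A_j = c_{r_j}P_{r_j}`,
`B_j = −c_{s_j}P_{s_j}`; hence `roots⁺(F) ≤ (n − 8) + R` for any bound `R` on its positive roots. [folklore] -/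
theorem countP_posRoots_rsum_le_of_twoRow₄_pos {n : ℕ} (e : ℕ → ℕ) (c : ℕ → ℝ)
    (r₁ r₂ r₃ r₄ s₁ s₂ s₃ s₄ : ℕ) (hr₁n : r₁ < n) (hr₂n : r₂ < n) (hr₃n : r₃ < n) (hr₄n : r₄ < n) (hs₁n : s₁ < n) (hs₂n : s₂ < n) (hs₃n : s₃ < n) (hs₄n : s₄ < n)
    (hnodup : List.Nodup [r₁, r₂, r₃, r₄, s₁, s₂, s₃, s₄])
    (a b d₁ d₂ d₃ d₄ : ℕ) (her₁ : e r₁ = a + d₁) (her₂ : e r₂ = a + d₂) (her₃ : e r₃ = a + d₃) (her₄ : e r₄ = a + d₄) (hes₁ : e s₁ = b + d₁) (hes₂ : e s₂ = b + d₂) (hes₃ : e s₃ = b + d₃) (hes₄ : e s₄ = b + d₄)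
    (Pr₁ Pr₂ Pr₃ Pr₄ Ps₁ Ps₂ Ps₃ Ps₄ : ℝ)
    (hPr₁ : ∏ v ∈ ((range n).filter (fun v => ¬(v = r₁ ∨ v = r₂ ∨ v = r₃ ∨ v = r₄ ∨ v = s₁ ∨ v = s₂ ∨ v = s₃ ∨ v = s₄))), ((e r₁ : ℝ) - e v) = Pr₁)
    (hPr₂ : ∏ v ∈ ((range n).filter (fun v => ¬(v = r₁ ∨ v = r₂ ∨ v = r₃ ∨ v = r₄ ∨ v = s₁ ∨ v = s₂ ∨ v = s₃ ∨ v = s₄))), ((e r₂ : ℝ) - e v) = Pr₂)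
    (hPr₃ : ∏ v ∈ ((range n).filter (fun v => ¬(v = r₁ ∨ v = r₂ ∨ v = r₃ ∨ v = r₄ ∨ v = s₁ ∨ v = s₂ ∨ v = s₃ ∨ v = s₄))), ((e r₃ : ℝ) - e v) = Pr₃)
    (hPr₄ : ∏ v ∈ ((range n).filter (fun v => ¬(v = r₁ ∨ v = r₂ ∨ v = r₃ ∨ v = r₄ ∨ v = s₁ ∨ v = s₂ ∨ v = s₃ ∨ v = s₄))), ((e r₄ : ℝ) - e v) = Pr₄)
    (hPs₁ : ∏ v ∈ ((range n).filter (fun v => ¬(v = r₁ ∨ v = r₂ ∨ v = r₃ ∨ v = r₄ ∨ v = s₁ ∨ v = s₂ ∨ v = s₃ ∨ v = s₄))), ((e s₁ : ℝ) - e v) = Ps₁)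
    (hPs₂ : ∏ v ∈ ((range n).filter (fun v => ¬(v = r₁ ∨ v = r₂ ∨ v = r₃ ∨ v = r₄ ∨ v = s₁ ∨ v = s₂ ∨ v = s₃ ∨ v = s₄))), ((e s₂ : ℝ) - e v) = Ps₂)
    (hPs₃ : ∏ v ∈ ((range n).filter (fun v => ¬(v = r₁ ∨ v = r₂ ∨ v = r₃ ∨ v = r₄ ∨ v = s₁ ∨ v = s₂ ∨ v = s₃ ∨ v = s₄))), ((e s₃ : ℝ) - e v) = Ps₃)
    (hPs₄ : ∏ v ∈ ((range n).filter (fun v => ¬(v = r₁ ∨ v = r₂ ∨ v = r₃ ∨ v = r₄ ∨ v = s₁ ∨ v = s₂ ∨ v = s₃ ∨ v = s₄))), ((e s₄ : ℝ) - e v) = Ps₄)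
    (R : ℕ) (hres : (C (c r₁ * Pr₁) * X ^ (a + d₁) + C (c r₂ * Pr₂) * X ^ (a + d₂) + C (c r₃ * Pr₃) * X ^ (a + d₃) + C (c r₄ * Pr₄) * X ^ (a + d₄) - (C (-(c s₁ * Ps₁)) * X ^ (b + d₁) + C (-(c s₂ * Ps₂)) * X ^ (b + d₂) + C (-(c s₃ * Ps₃)) * X ^ (b + d₃) + C (-(c s₄ * Ps₄)) * X ^ (b + d₄)) : ℝ[X]).roots.countP (fun x => 0 < x) ≤ R) :
    (∑ t ∈ range n, C (c t) * X ^ (e t) : ℝ[X]).roots.countP (fun x => 0 < x) ≤ (n - 8) + R := by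
  classical
  set U : Finset ℕ := ((range n).filter (fun v => ¬(v = r₁ ∨ v = r₂ ∨ v = r₃ ∨ v = r₄ ∨ v = s₁ ∨ v = s₂ ∨ v = s₃ ∨ v = s₄))) with hU_def
  have hK : (range n).filter (fun v => v = r₁ ∨ v = r₂ ∨ v = r₃ ∨ v = r₄ ∨ v = s₁ ∨ v = s₂ ∨ v = s₃ ∨ v = s₄) = insert r₁ (insert r₂ (insert r₃ (insert r₄ (insert s₁ (insert s₂ (insert s₃ {s₄})))))) := by
    ext v
    simp only [mem_filter, mem_range, mem_insert, mem_singleton]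
    constructor
    · rintro ⟨-, h⟩; exact h
    · intro h; refine ⟨?_, h⟩; rcases h with rfl | rfl | rfl | rfl | rfl | rfl | rfl | rfl <;> assumption
  simp only [List.nodup_cons, List.mem_cons, List.not_mem_nil, List.nodup_nil, not_or, or_false, and_true] at hnodup
  have hn1 : r₁ ∉ (insert r₂ (insert r₃ (insert r₄ (insert s₁ (insert s₂ (insert s₃ {s₄}))))) : Finset ℕ) := by simp only [mem_insert, mem_singleton, not_or]; exact hnodup.1
  have hn2 : r₂ ∉ (insert r₃ (insert r₄ (insert s₁ (insert s₂ (insert s₃ {s₄})))) : Finset ℕ) := by simp only [mem_insert, mem_singleton, not_or]; exact hnodup.2.1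
  have hn3 : r₃ ∉ (insert r₄ (insert s₁ (insert s₂ (insert s₃ {s₄}))) : Finset ℕ) := by simp only [mem_insert, mem_singleton, not_or]; exact hnodup.2.2.1
  have hn4 : r₄ ∉ (insert s₁ (insert s₂ (insert s₃ {s₄})) : Finset ℕ) := by simp only [mem_insert, mem_singleton, not_or]; exact hnodup.2.2.2.1
  have hn5 : s₁ ∉ (insert s₂ (insert s₃ {s₄}) : Finset ℕ) := by simp only [mem_insert, mem_singleton, not_or]; exact hnodup.2.2.2.2.1
  have hn6 : s₂ ∉ (insert s₃ {s₄} : Finset ℕ) := by simp only [mem_insert, mem_singleton, not_or]; exact hnodup.2.2.2.2.2.1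
  have hn7 : s₃ ∉ ({s₄} : Finset ℕ) := by simp only [mem_singleton]; exact hnodup.2.2.2.2.2.2.1
  have hKcard : (insert r₁ (insert r₂ (insert r₃ (insert r₄ (insert s₁ (insert s₂ (insert s₃ {s₄})))))) : Finset ℕ).card = 8 := by
    rw [card_insert_of_notMem hn1, card_insert_of_notMem hn2, card_insert_of_notMem hn3, card_insert_of_notMem hn4, card_insert_of_notMem hn5, card_insert_of_notMem hn6, card_insert_of_notMem hn7, card_singleton]
  have hUcard : U.card = n - 8 := by
    have h := Finset.card_filter_add_card_filter_not (s := range n) (fun v => v = r₁ ∨ v = r₂ ∨ v = r₃ ∨ v = r₄ ∨ v = s₁ ∨ v = s₂ ∨ v = s₃ ∨ v = s₄)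
    rw [hK, hKcard, card_range] at h
    rw [hU_def]; omega
  -- capacity
  have step := countP_posRoots_le_countP_twists n e c U
  -- the residual
  have hres_eq : (∑ t ∈ range n, C (c t * ∏ u ∈ U, ((e t : ℝ) - e u)) * X ^ (e t) : ℝ[X]) = (C (c r₁ * Pr₁) * X ^ (a + d₁) + C (c r₂ * Pr₂) * X ^ (a + d₂) + C (c r₃ * Pr₃) * X ^ (a + d₃) + C (c r₄ * Pr₄) * X ^ (a + d₄) - (C (-(c s₁ * Ps₁)) * X ^ (b + d₁) + C (-(c s₂ * Ps₂)) * X ^ (b + d₂) + C (-(c s₃ * Ps₃)) * X ^ (b + d₃) + C (-(c s₄ * Ps₄)) * X ^ (b + d₄)) : ℝ[X]) := by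
    rw [← Finset.sum_filter_add_sum_filter_not (range n) (fun v => v = r₁ ∨ v = r₂ ∨ v = r₃ ∨ v = r₄ ∨ v = s₁ ∨ v = s₂ ∨ v = s₃ ∨ v = s₄), hK]
    have hzero : ∑ t ∈ (range n).filter (fun v => ¬(v = r₁ ∨ v = r₂ ∨ v = r₃ ∨ v = r₄ ∨ v = s₁ ∨ v = s₂ ∨ v = s₃ ∨ v = s₄)), (C (c t * ∏ u ∈ U, ((e t : ℝ) - e u)) * X ^ (e t) : ℝ[X]) = 0 := by
      refine Finset.sum_eq_zero fun t ht => ?_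
      have htU : t ∈ U := by rw [hU_def]; exact ht
      rw [Finset.prod_eq_zero htU (sub_self _), mul_zero, map_zero, zero_mul]
    rw [hzero, add_zero]
    rw [Finset.sum_insert hn1, Finset.sum_insert hn2, Finset.sum_insert hn3, Finset.sum_insert hn4, Finset.sum_insert hn5, Finset.sum_insert hn6, Finset.sum_insert hn7, Finset.sum_singleton]
    rw [hPr₁, hPr₂, hPr₃, hPr₄, hPs₁, hPs₂, hPs₃, hPs₄, her₁, her₂, her₃, her₄, hes₁, hes₂, hes₃, hes₄]
    simp only [map_neg, map_mul]
    ring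
  rw [hres_eq, hUcard] at step
  omega

/-- **Wrapper, `m = 4`, orientation `neg`.**  Killing every exponent of `F = Σ_{t<n} c_t X^{e_t}` except the kept
`r_j` (`e = a + d_j`) and `s_j` (`e = b + d_j`) leaves the two-row residual with `A_j = −c_{r_j}P_{r_j}`,
`B_j = c_{s_j}P_{s_j}`; hence `roots⁺(F) ≤ (n − 8) + R` for any bound `R` on its positive roots. [folklore] -/
theorem countP_posRoots_rsum_le_of_twoRow₄_neg {n : ℕ} (e : ℕ → ℕ) (c : ℕ → ℝ)
    (r₁ r₂ r₃ r₄ s₁ s₂ s₃ s₄ : ℕ) (hr₁n : r₁ < n) (hr₂n : r₂ < n) (hr₃n : r₃ < n) (hr₄n : r₄ < n) (hs₁n : s₁ < n) (hs₂n : s₂ < n) (hs₃n : s₃ < n) (hs₄n : s₄ < n)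
    (hnodup : List.Nodup [r₁, r₂, r₃, r₄, s₁, s₂, s₃, s₄])
    (a b d₁ d₂ d₃ d₄ : ℕ) (her₁ : e r₁ = a + d₁) (her₂ : e r₂ = a + d₂) (her₃ : e r₃ = a + d₃) (her₄ : e r₄ = a + d₄) (hes₁ : e s₁ = b + d₁) (hes₂ : e s₂ = b + d₂) (hes₃ : e s₃ = b + d₃) (hes₄ : e s₄ = b + d₄)
    (Pr₁ Pr₂ Pr₃ Pr₄ Ps₁ Ps₂ Ps₃ Ps₄ : ℝ)
    (hPr₁ : ∏ v ∈ ((range n).filter (fun v => ¬(v = r₁ ∨ v = r₂ ∨ v = r₃ ∨ v = r₄ ∨ v = s₁ ∨ v = s₂ ∨ v = s₃ ∨ v = s₄))), ((e r₁ : ℝ) - e v) = Pr₁)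
    (hPr₂ : ∏ v ∈ ((range n).filter (fun v => ¬(v = r₁ ∨ v = r₂ ∨ v = r₃ ∨ v = r₄ ∨ v = s₁ ∨ v = s₂ ∨ v = s₃ ∨ v = s₄))), ((e r₂ : ℝ) - e v) = Pr₂)
    (hPr₃ : ∏ v ∈ ((range n).filter (fun v => ¬(v = r₁ ∨ v = r₂ ∨ v = r₃ ∨ v = r₄ ∨ v = s₁ ∨ v = s₂ ∨ v = s₃ ∨ v = s₄))), ((e r₃ : ℝ) - e v) = Pr₃)
    (hPr₄ : ∏ v ∈ ((range n).filter (fun v => ¬(v = r₁ ∨ v = r₂ ∨ v = r₃ ∨ v = r₄ ∨ v = s₁ ∨ v = s₂ ∨ v = s₃ ∨ v = s₄))), ((e r₄ : ℝ) - e v) = Pr₄)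
    (hPs₁ : ∏ v ∈ ((range n).filter (fun v => ¬(v = r₁ ∨ v = r₂ ∨ v = r₃ ∨ v = r₄ ∨ v = s₁ ∨ v = s₂ ∨ v = s₃ ∨ v = s₄))), ((e s₁ : ℝ) - e v) = Ps₁)
    (hPs₂ : ∏ v ∈ ((range n).filter (fun v => ¬(v = r₁ ∨ v = r₂ ∨ v = r₃ ∨ v = r₄ ∨ v = s₁ ∨ v = s₂ ∨ v = s₃ ∨ v = s₄))), ((e s₂ : ℝ) - e v) = Ps₂)
    (hPs₃ : ∏ v ∈ ((range n).filter (fun v => ¬(v = r₁ ∨ v = r₂ ∨ v = r₃ ∨ v = r₄ ∨ v = s₁ ∨ v = s₂ ∨ v = s₃ ∨ v = s₄))), ((e s₃ : ℝ) - e v) = Ps₃)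
    (hPs₄ : ∏ v ∈ ((range n).filter (fun v => ¬(v = r₁ ∨ v = r₂ ∨ v = r₃ ∨ v = r₄ ∨ v = s₁ ∨ v = s₂ ∨ v = s₃ ∨ v = s₄))), ((e s₄ : ℝ) - e v) = Ps₄)
    (R : ℕ) (hres : (C (-(c r₁ * Pr₁)) * X ^ (a + d₁) + C (-(c r₂ * Pr₂)) * X ^ (a + d₂) + C (-(c r₃ * Pr₃)) * X ^ (a + d₃) + C (-(c r₄ * Pr₄)) * X ^ (a + d₄) - (C (c s₁ * Ps₁) * X ^ (b + d₁) + C (c s₂ * Ps₂) * X ^ (b + d₂) + C (c s₃ * Ps₃) * X ^ (b + d₃) + C (c s₄ * Ps₄) * X ^ (b + d₄)) : ℝ[X]).roots.countP (fun x => 0 < x) ≤ R) :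
    (∑ t ∈ range n, C (c t) * X ^ (e t) : ℝ[X]).roots.countP (fun x => 0 < x) ≤ (n - 8) + R := by
  classical
  set U : Finset ℕ := ((range n).filter (fun v => ¬(v = r₁ ∨ v = r₂ ∨ v = r₃ ∨ v = r₄ ∨ v = s₁ ∨ v = s₂ ∨ v = s₃ ∨ v = s₄))) with hU_def
  have hK : (range n).filter (fun v => v = r₁ ∨ v = r₂ ∨ v = r₃ ∨ v = r₄ ∨ v = s₁ ∨ v = s₂ ∨ v = s₃ ∨ v = s₄) = insert r₁ (insert r₂ (insert r₃ (insert r₄ (insert s₁ (insert s₂ (insert s₃ {s₄})))))) := by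
    ext v
    simp only [mem_filter, mem_range, mem_insert, mem_singleton]
    constructor
    · rintro ⟨-, h⟩; exact h
    · intro h; refine ⟨?_, h⟩; rcases h with rfl | rfl | rfl | rfl | rfl | rfl | rfl | rfl <;> assumption
  simp only [List.nodup_cons, List.mem_cons, List.not_mem_nil, List.nodup_nil, not_or, or_false, and_true] at hnodup
  have hn1 : r₁ ∉ (insert r₂ (insert r₃ (insert r₄ (insert s₁ (insert s₂ (insert s₃ {s₄}))))) : Finset ℕ) := by simp only [mem_insert, mem_singleton, not_or]; exact hnodup.1
  have hn2 : r₂ ∉ (insert r₃ (insert r₄ (insert s₁ (insert s₂ (insert s₃ {s₄})))) : Finset ℕ) := by simp only [mem_insert, mem_singleton, not_or]; exact hnodup.2.1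
  have hn3 : r₃ ∉ (insert r₄ (insert s₁ (insert s₂ (insert s₃ {s₄}))) : Finset ℕ) := by simp only [mem_insert, mem_singleton, not_or]; exact hnodup.2.2.1
  have hn4 : r₄ ∉ (insert s₁ (insert s₂ (insert s₃ {s₄})) : Finset ℕ) := by simp only [mem_insert, mem_singleton, not_or]; exact hnodup.2.2.2.1
  have hn5 : s₁ ∉ (insert s₂ (insert s₃ {s₄}) : Finset ℕ) := by simp only [mem_insert, mem_singleton, not_or]; exact hnodup.2.2.2.2.1
  have hn6 : s₂ ∉ (insert s₃ {s₄} : Finset ℕ) := by simp only [mem_insert, mem_singleton, not_or]; exact hnodup.2.2.2.2.2.1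
  have hn7 : s₃ ∉ ({s₄} : Finset ℕ) := by simp only [mem_singleton]; exact hnodup.2.2.2.2.2.2.1
  have hKcard : (insert r₁ (insert r₂ (insert r₃ (insert r₄ (insert s₁ (insert s₂ (insert s₃ {s₄})))))) : Finset ℕ).card = 8 := by
    rw [card_insert_of_notMem hn1, card_insert_of_notMem hn2, card_insert_of_notMem hn3, card_insert_of_notMem hn4, card_insert_of_notMem hn5, card_insert_of_notMem hn6, card_insert_of_notMem hn7, card_singleton]
  have hUcard : U.card = n - 8 := by
    have h := Finset.card_filter_add_card_filter_not (s := range n) (fun v => v = r₁ ∨ v = r₂ ∨ v = r₃ ∨ v = r₄ ∨ v = s₁ ∨ v = s₂ ∨ v = s₃ ∨ v = s₄)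
    rw [hK, hKcard, card_range] at h
    rw [hU_def]; omega
  -- capacity
  have step := countP_posRoots_le_countP_twists n e c U
  -- the residual
  have hres_eq : (∑ t ∈ range n, C (c t * ∏ u ∈ U, ((e t : ℝ) - e u)) * X ^ (e t) : ℝ[X]) = -(C (-(c r₁ * Pr₁)) * X ^ (a + d₁) + C (-(c r₂ * Pr₂)) * X ^ (a + d₂) + C (-(c r₃ * Pr₃)) * X ^ (a + d₃) + C (-(c r₄ * Pr₄)) * X ^ (a + d₄) - (C (c s₁ * Ps₁) * X ^ (b + d₁) + C (c s₂ * Ps₂) * X ^ (b + d₂) + C (c s₃ * Ps₃) * X ^ (b + d₃) + C (c s₄ * Ps₄) * X ^ (b + d₄)) : ℝ[X]) := by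
    rw [← Finset.sum_filter_add_sum_filter_not (range n) (fun v => v = r₁ ∨ v = r₂ ∨ v = r₃ ∨ v = r₄ ∨ v = s₁ ∨ v = s₂ ∨ v = s₃ ∨ v = s₄), hK]
    have hzero : ∑ t ∈ (range n).filter (fun v => ¬(v = r₁ ∨ v = r₂ ∨ v = r₃ ∨ v = r₄ ∨ v = s₁ ∨ v = s₂ ∨ v = s₃ ∨ v = s₄)), (C (c t * ∏ u ∈ U, ((e t : ℝ) - e u)) * X ^ (e t) : ℝ[X]) = 0 := by
      refine Finset.sum_eq_zero fun t ht => ?_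
      have htU : t ∈ U := by rw [hU_def]; exact ht
      rw [Finset.prod_eq_zero htU (sub_self _), mul_zero, map_zero, zero_mul]
    rw [hzero, add_zero]
    rw [Finset.sum_insert hn1, Finset.sum_insert hn2, Finset.sum_insert hn3, Finset.sum_insert hn4, Finset.sum_insert hn5, Finset.sum_insert hn6, Finset.sum_insert hn7, Finset.sum_singleton]
    rw [hPr₁, hPr₂, hPr₃, hPr₄, hPs₁, hPs₂, hPs₃, hPs₄, her₁, her₂, her₃, her₄, hes₁, hes₂, hes₃, hes₄]
    simp only [map_neg, map_mul]
    ring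
  rw [hres_eq, roots_neg, hUcard] at step
  omega

end Summit.ValiantsHypothesis.ValiantsHypothesis.Theorems.LacunarySymmetroidMatrixDescartes.Census
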